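import Mathlib
import Summits.Ventures.PercRepro.TriangleCapEqualityLocus

/-!
# PercRepro — THE LINE `k − r = 6`: THE EXTREMAL GRAPHS OF THE CELLS `(k, 3, k − 6)` ARE THE STAR-SHAPED ONES AND
THE HANGINGS (p3, gen 41; part 171)

The cells excluded by part 168 are exactly `(k, a, r) = (k, 3, k − 6)`, `k ≥ 7` (`2a + r ≤ k` forces `a = 3` when
`k − r = 6`): `m = 2k − 3` edges and the closed form `Σ_v d(v)² = m k − 5 (k − 6) = 2k² − 8k + 30`. There the
degree argument at equality gives a RECURSIVE description (`line_eq_iff`): a `K₄⁻`-free graph on `k ≥ 7` vertices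
with `2k − 3` edges is extremal iff it is `K_{3, k−3}` minus a star of `k − 6` edges at one vertex, or it HANGS — it
has a vertex `z` of degree `2` whose two neighbours have degree `k − 3` and whose deletion is extremal on the line
one step down. (At `k = 7` the hangings on `K_{3,3}` and on the prism give the four extremal types of §10as(d):
`K_{3,4} − e`, `K_{3,3}` plus a vertex on an edge, the prism plus a vertex on a rung, the prism plus a vertex on a
non-adjacent pair — `420 + 630 + 1260 + 2520 = 4830` labelled graphs, the census of part 168.) The star-shaped
extremal graphs that are not hangings are the two cells `k = 8, 9` where a pendant or an isolated vertex hangs on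
the diagonal. Axioms: standard.
-/

namespace PercRepro

namespace TriangleCap

namespace C047

open Finset

variable {V : Type*} [Fintype V] [DecidableEq V]

/-- **A HANGING IS EXTREMAL:** a vertex `z` of degree `2` whose two neighbours have degree `k − 3`, deleted onto an
extremal graph of the line at `k − 1`, gives an extremal graph of the line at `k`. -/
theorem line_eq_of_hang (D : SimpleGraph V) [DecidableRel D.Adj] (hk : 7 ≤ Fintype.card V)
    (hm : D.edgeFinset.card + 3 = 2 * Fintype.card V) {z : V} (hz : deg D z = 2)
    (hnb : ∀ x : {v : V // v ≠ z}, D.Adj x.1 z → deg D x.1 + 3 = Fintype.card V)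
    (heq' : ∑ v, deg (del D z) v * deg (del D z) v + (Fintype.card {v : V // v ≠ z} - 6) * 5 =
      (del D z).edgeFinset.card * Fintype.card {v : V // v ≠ z}) :
    ∑ v, deg D v * deg D v + (Fintype.card V - 6) * 5 = D.edgeFinset.card * Fintype.card V := by
  have hcard := card_del z
  have hedges := card_edges_del D z
  have hsq := sum_deg_sq_del D z
  have hT : ∑ a : {v : V // v ≠ z}, (if D.Adj a.1 z then deg (del D z) a else 0) =
      ∑ a : {v : V // v ≠ z}, (if D.Adj a.1 z then Fintype.card V - 4 else 0) := by
    apply sum_congr rfl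
    intro a _
    by_cases h : D.Adj a.1 z
    · simp only [h, if_true]
      have h1 := deg_del D z a
      simp only [h, if_true] at h1
      have := hnb a h
      omega
    · simp only [h, if_false]
  rw [sum_del_nbhd_const, hz] at hT
  rw [hsq, hT, hz]
  obtain ⟨k', hk'⟩ : ∃ k', Fintype.card V = k' + 7 := ⟨Fintype.card V - 7, by omega⟩
  rw [hk'] at hcard hm ⊢
  have e1 : Fintype.card {v : V // v ≠ z} = k' + 6 := by omega
  rw [e1] at heq'
  have e2 : k' + 7 - 6 = k' + 1 := by omega
  have e3 : k' + 6 - 6 = k' := by omega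
  have e4 : k' + 7 - 4 = k' + 3 := by omega
  rw [e2, e4]
  rw [e3] at heq'
  have hm' : (del D z).edgeFinset.card = 2 * k' + 9 := by omega
  rw [hm'] at heq'
  have hmD : D.edgeFinset.card = 2 * k' + 11 := by omega
  rw [hmD]
  nlinarith [heq']

/-- **THE LINE `k − r = 6`, THE RECURSION:** a `K₄⁻`-free graph on `k ≥ 7` vertices with `2k − 3` edges attains
`Σ_v d(v)² = m k − 5 (k − 6)` iff it is `K_{3, k−3}` minus a star of `k − 6` edges at one vertex, or it has a
vertex `z` of degree `2` whose two neighbours have degree `k − 3` and whose deletion is extremal on the line at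
`k − 1`. -/
theorem line_eq_iff (D : SimpleGraph V) [DecidableRel D.Adj] (hK : K4mFree D) (hk : 7 ≤ Fintype.card V)
    (hm : D.edgeFinset.card + 3 = 2 * Fintype.card V) :
    ∑ v, deg D v * deg D v + (Fintype.card V - 6) * 5 = D.edgeFinset.card * Fintype.card V ↔
      (∃ (A : Finset V) (v : V), A.card = 3 ∧ BipSub D A ∧ MissingStar D A v) ∨
      (∃ z, deg D z = 2 ∧ (∀ x : {v : V // v ≠ z}, D.Adj x.1 z → deg D x.1 + 3 = Fintype.card V) ∧
        ∑ v, deg (del D z) v * deg (del D z) v + (Fintype.card {v : V // v ≠ z} - 6) * 5 =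
          (del D z).edgeFinset.card * Fintype.card {v : V // v ≠ z}) := by
  -- the cell `(k, 3, k − 6)`
  have hcell : D.edgeFinset.card + 3 * 3 + (Fintype.card V - 6) = 3 * Fintype.card V := by omega
  have hr : (Fintype.card V - 6) * (Fintype.card V - 1 - (Fintype.card V - 6)) = (Fintype.card V - 6) * 5 := by
    congr 1
    omega
  have hcell' := cell_edges 3 (Fintype.card V - 6) (Fintype.card V) D.edgeFinset.card hcell (by omega)
  constructor
  · intro heq
    rw [← hr] at heq
    have hcap : ∀ v, deg D v + 3 ≤ Fintype.card V := fun v =>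
      deg_add_le_card_of_dense D hK 3 (le_refl 3) (by omega)
        (cap_arith 3 (Fintype.card V) D.edgeFinset.card (Fintype.card V - 6) (by omega) (by omega) hcell) v
    by_cases hdeg : ∀ z, 3 ≤ deg D z
    · exfalso
      have h1 := band_stability_of_min_degree_strict D 3 (Fintype.card V - 6) hcap hdeg (by omega) hcell
      have h2 : (Fintype.card V - 6) * (Fintype.card V - 1 - (Fintype.card V - 6)) <
          (Fintype.card V - 6) * Fintype.card V :=
        Nat.mul_lt_mul_of_pos_left (by omega) (by omega)
      omega
    push Not at hdeg
    obtain ⟨z, hz⟩ := hdeg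
    rcases Nat.lt_or_ge (Fintype.card V - 6 + deg D z) 3 with hcross | hwithin
    · exfalso
      have := band_of_low_degree_cross_strict D hK 3 (Fintype.card V - 6) hcap (z := z) (by omega) (by omega)
        hk hcell
      omega
    · have hK' := k4mFree_del D hK z
      have hcard' := card_del z
      have hedges' := card_edges_del D z
      have hm' : (del D z).edgeFinset.card + 3 * 3 + (Fintype.card V - 6 + deg D z - 3) =
          3 * Fintype.card {v : V // v ≠ z} := by omega
      have hrow := closed_form_stability (del D z) hK' 3 (Fintype.card V - 6 + deg D z - 3) (le_refl 3)
        (by omega) hm'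
      obtain ⟨hcase, hnb, heq'⟩ :=
        band_of_low_degree_eq D 3 (Fintype.card V - 6) hcap (z := z) (by omega) hwithin (by omega) hcell hrow heq
      rcases Nat.lt_or_ge (deg D z) 2 with hd | hd
      · -- `d ≤ 1`: the diagonal at `k − 1 ∈ {7, 8}`, complete bipartite, the transport, the star
        left
        have hr' : Fintype.card V - 6 + deg D z - 3 = 0 := by omega
        rw [hr'] at heq' hm'
        simp only [zero_mul, add_zero] at heq' hm'
        have h2 : 2 * cherries (del D z) + 2 * (del D z).edgeFinset.card =
            (del D z).edgeFinset.card * Fintype.card {v : V // v ≠ z} := by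
          have := two_mul_cherries_add (del D z)
          have := sum_deg_eq (del D z)
          omega
        obtain ⟨A', hA'⟩ := (dense_eq_iff (del D z) hK' (by omega)).mp h2
        have hsub' : BipSub (del D z) A' := bipSub_of_xor (del D z) A' hA'
        have hcardE := card_edges_eq_of_complete_bipartite (del D z) A' hA'
        have hcell3 : (del D z).edgeFinset.card = 3 * (Fintype.card {v : V // v ≠ z} - 3) := by
          have := cell_edges 3 0 (Fintype.card {v : V // v ≠ z}) (del D z).edgeFinset.card
            (by simpa using hm') (by omega)
          simpa using this
        obtain ⟨A'', hA''3, hsub''⟩ : ∃ A'' : Finset {v : V // v ≠ z}, A''.card = 3 ∧ BipSub (del D z) A'' := by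
          rcases eq_or_eq_of_mul_sub_eq A'.card 3 (Fintype.card {v : V // v ≠ z}) (card_le_univ A') (by omega)
            (by omega) with h | h
          · exact ⟨A', h, hsub'⟩
          · exact ⟨A'ᶜ, by rw [card_compl]; omega, bipSub_compl (del D z) A' hsub'⟩
        obtain ⟨A, hA, hsub⟩ := bipSub_of_del D hK z 3 A'' hA''3 hsub'' hnb (Or.inl (by omega))
        obtain ⟨v, hv⟩ := exists_missingStar_of_closed_form_eq D A hsub 3 (Fintype.card V - 6) hA hcell'
          (by omega) heq
        exact ⟨A, v, hA, hsub, hv⟩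
      · -- `d = 2`: the hanging
        right
        have hd2 : deg D z = 2 := by omega
        refine ⟨z, hd2, hnb, ?_⟩
        have e1 : Fintype.card V - 6 + deg D z - 3 = Fintype.card {v : V // v ≠ z} - 6 := by omega
        have e2 : Fintype.card {v : V // v ≠ z} - 1 - (Fintype.card {v : V // v ≠ z} - 6) = 5 := by omega
        rw [e1, e2] at heq'
        exact heq'
  · rintro (⟨A, v, hA, hsub, hv⟩ | ⟨z, hz, hnb, heq'⟩)
    · have := closed_form_eq_of_missingStar D A hsub hv 3 (Fintype.card V - 6) hA hcell' (by omega)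
      rw [hr] at this
      exact this
    · exact line_eq_of_hang D hk hm hz hnb heq'

end C047

end TriangleCap

end PercRepro
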